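import Summits.QuantumFields.BalabanUV.T4Continuum.Support.ShellMeasureLinearizedChart

/-!
# `T4Continuum.ShellMeasureLinearizedDisintegration` — the DISINTEGRATION FORMULA along a linearizable average, in
# integrated form: `c · ∫ g(Q y, y) dν(y) = ∫ db ∫ g(b, Φ(σ b + Ψ(x,0))) · Gt(σ b + Ψ(x,0)) dμK(x)` — conditionally on
# the average `Q = b` the block variable is the curved-chart image of Lebesgue measure on the linear fibre weighted by
# the pulled-back density (the kernel form of print's «δ(Q̃B)» after the substitution)
# (cell `pub-balaban`, sub-cell `t4`, spine estimate NE7c (node U5b); NE7c ROUND-2 crew `t4-ne7c-formalise-*`, seat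
# `b2b-balaban-t4-ne7c-formalise-leaf-09` (gen 7); file 4 of the OFFER «the curved fibre chart for a linearizable
# average» (journal `CLAIMS.log` l.11567); ADDITIVE — imports file 1 `ShellMeasureLinearizedChart` only; 0 `def`,
# 0 sorry, 0 cite)

HONEST FRAMING.  Finite four-torus programme, rung (B)+1 only — NOT infinite volume, NOT a mass gap, NOT the Clay
problem, NOT summit progress.  [folklore] measure theory (Tonelli + file 1's change of variables); nothing of
Bałaban's is asserted; NE7c ⇐ the named binders; NE7c NOT PRINTED, NOT proved; spine PROVED 0/9.  HONEST DEPENDENCY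
(cell, verbatim): continuum YM on T⁴ ⇐ BetaPertH ∧ nine spine estimates (0/9 proved); BetaPertH ⇐ (D1) ∧ (D4) ∧
CAP+tail; G-an2-4 gates asym, D1 and NE2/3/4.

THE POINT.  File 1's `map_linearizedChart_eq_smul` identifies the block law `ν = (μE⌞Φ(O)).withDensity G` with
`c⁻¹ ×` the image of the tilted product law under the full chart.  Adding the LINEARIZATION hypothesis
`hlin : Q (Φ y) = (Ψ.symm y).2` on `O` (print's «B′ = B − hD̃(B) linearizes Q̃(B′)»; supplied for print's substitution
by file 2 `ShellMeasureLinearizedConstraint.substitution_linearizes`) turns it into the DISINTEGRATION OF `ν` ALONG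
THE NONLINEAR AVERAGE `Q`, stated as an identity of iterated integrals for every measurable `g ≥ 0` on `F × E`
(`lintegral_average_linearizedChart`): the joint law of `(Q y, y)` under `ν` is `c⁻¹ · db ⊗ (fibre law at b)`, the
fibre law at `b` being «`x ↦ Φ(σ b + Ψ(x,0))` pushes `Gt(σ b + Ψ(x,0)) dμK(x)`» — it lives on the fibre `{Q = b}`
(file 1 `average_linearizedChart`) and its mass is the marginal density of `Q` at `b` (`lintegral_average_marginal`,
the case `g(b, y) = φ(b)`).  This is the shape `∫ g(avg U, U) dν(U) = ∫ h(V) (∫ g(V, U) condLaw(V, dU)) dμ(V)` of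
`T4AveragingDisintegration.integral_graph_eq` with the conditional law EXPLICIT (up to normalisation by its mass) —
the reading a [dict] seat needs to identify the cell's `condLaw` presentation of a renormalization step with the
curved-chart fibre laws of files 1–2, for a linearizable average.  Nothing is normalised here (the fibre masses may
vanish or, without finiteness of `ν`, be infinite); no `condKernel` uniqueness is invoked.
WHAT THIS DOES NOT DO.  It does not show Bałaban's block average linearizable (print's statement, typed in
`B12Lineariz267`), identifies no slot density with print's integrand, discharges no SM-L binder; (M1) stays THE wall.
-/

noncomputable section

open Set Function MeasureTheory MeasureTheory.Measure Metric

namespace Summit.QuantumFields.BalabanUV.T4Continuum.ShellMeasureLinearizedDisintegration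

open scoped ENNReal NNReal
open Literature.MathematicalPhysics.QuantumFieldTheory.Balaban1983to89
open ShellMeasureWindowSection (average_sectionChart measurePreserving_sectionChart)
open ShellMeasureLinearizedChart (map_linearizedChart_eq_smul average_linearizedChart)

variable {E F Kf : Type*} [NormedAddCommGroup E] [NormedSpace ℝ E] [MeasurableSpace E] [BorelSpace E]
  [FiniteDimensional ℝ E] (μE : Measure E) [μE.IsAddHaarMeasure]
  [NormedAddCommGroup F] [NormedSpace ℝ F] [MeasurableSpace F] [BorelSpace F] [FiniteDimensional ℝ F]
  [NormedAddCommGroup Kf] [NormedSpace ℝ Kf] [MeasurableSpace Kf] [BorelSpace Kf] [FiniteDimensional ℝ Kf]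
  (μK : Measure Kf) [μK.IsAddHaarMeasure] (μF : Measure F) [μF.IsAddHaarMeasure]

/-- **DISINTEGRATION ALONG A LINEARIZABLE AVERAGE (integrated form).**  Data as in file 1's
`map_linearizedChart_eq_smul` (splitting `Ψ`, measurable section `σ`, measurable window `O`, measurable chart `Φ`
injective on `O` with derivative `Φ'` within `O`, density `G`, measurable pulled-back density
`Gt = 1_O·|det Φ'|·G∘Φ`) plus a measurable average `Q : E → F` LINEARIZED by `Φ` on `O` (`hlin`).  Then for every
measurable `g : F × E → ℝ≥0∞`:
`c · ∫ g (Q y, y) d((μE⌞Φ(O)).withDensity G)(y) = ∫_F ∫_Kf g (b, Φ (σ b + Ψ (x, 0))) · Gt (σ b + Ψ (x, 0)) dμK(x) dμF(b)`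
with file 1's constant `0 < c < ∞`: conditionally on `Q = b`, the block variable is distributed as the curved-chart
image of `Gt (σ b + Ψ (·, 0)) dμK` (up to normalisation). [folklore] -/
theorem lintegral_average_linearizedChart (Ψ : (Kf × F) ≃L[ℝ] E) {σ : F → E} (hσm : Measurable σ)
    (hσ : ∀ b, (Ψ.symm (σ b)).2 = b) {O : Set E} (hO : MeasurableSet O) {Φ : E → E} (hΦm : Measurable Φ)
    (hinj : InjOn Φ O) {Φ' : E → E →L[ℝ] E} (hΦ' : ∀ y ∈ O, HasFDerivWithinAt Φ (Φ' y) O y)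
    (G : E → ℝ≥0∞) {Gt : E → ℝ≥0∞} (hGtm : Measurable Gt)
    (hGt : ∀ y, Gt y = O.indicator (fun y => ENNReal.ofReal |(Φ' y).det| * G (Φ y)) y)
    {Q : E → F} (hQ : Measurable Q) (hlin : ∀ y ∈ O, Q (Φ y) = (Ψ.symm y).2)
    {g : F × E → ℝ≥0∞} (hg : Measurable g) :
    ∃ c : ℝ≥0∞, c ≠ 0 ∧ c ≠ ∞ ∧
      c * ∫⁻ y, g (Q y, y) ∂((μE.restrict (Φ '' O)).withDensity G) =
        ∫⁻ b, ∫⁻ x, g (b, Φ (σ b + Ψ (x, 0))) * Gt (σ b + Ψ (x, 0)) ∂μK ∂μF := by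
  obtain ⟨c, hc0, hc1, hmap⟩ :=
    map_linearizedChart_eq_smul μE μK μF Ψ hσm hσ hO hΦm hinj hΦ' G hGtm hGt
  refine ⟨c, hc0, hc1, ?_⟩
  have hch : Measurable fun p : Kf × F => σ p.2 + Ψ (p.1, 0) :=
    (hσm.comp measurable_snd).add (Ψ.continuous.measurable.comp (measurable_fst.prodMk measurable_const))
  have hT : Measurable fun p : Kf × F => Φ (σ p.2 + Ψ (p.1, 0)) := hΦm.comp hch
  have hgQ : Measurable fun y : E => g (Q y, y) := hg.comp (hQ.prodMk measurable_id)
  -- the left side as an integral against the image measure `c • ν = (tilted product law).map (full chart)`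
  have hf' : Measurable fun p : Kf × F => Gt (σ p.2 + Ψ (p.1, 0)) := hGtm.comp hch
  have hg' : Measurable fun p : Kf × F => g (Q (Φ (σ p.2 + Ψ (p.1, 0))), Φ (σ p.2 + Ψ (p.1, 0))) :=
    hgQ.comp hT
  rw [← smul_eq_mul, ← lintegral_smul_measure, ← hmap, lintegral_map hgQ hT,
    lintegral_withDensity_eq_lintegral_mul _ hf' hg']
  -- pointwise: on the window the charted point has average `b`; off the window the pulled-back density vanishes
  have hpt : ∀ p : Kf × F, Gt (σ p.2 + Ψ (p.1, 0)) * g (Q (Φ (σ p.2 + Ψ (p.1, 0))), Φ (σ p.2 + Ψ (p.1, 0))) =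
      g (p.2, Φ (σ p.2 + Ψ (p.1, 0))) * Gt (σ p.2 + Ψ (p.1, 0)) := fun p => by
    by_cases hp : σ p.2 + Ψ (p.1, 0) ∈ O
    · rw [average_linearizedChart Ψ hσ hlin p.1 p.2 hp, mul_comm]
    · rw [hGt, indicator_of_notMem hp, zero_mul, mul_zero]
  simp only [Pi.mul_apply, hpt]
  -- Tonelli, average value outermost
  exact lintegral_prod_symm _ ((hg.comp (measurable_snd.prodMk hT)).mul (hGtm.comp hch)).aemeasurable

/-- **THE MARGINAL OF THE AVERAGE.**  The case `g (b, y) = φ b`: `c · ∫ φ (Q y) dν(y) = ∫ φ(b) · m(b) db` with the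
fibre mass `m b = ∫ Gt (σ b + Ψ (x, 0)) dμK(x)` — the law of the nonlinear average `Q` under the block law `ν` has
density `c⁻¹ · m` w.r.t. Lebesgue measure on `F` (print's normalisation factors live here). [folklore] -/
theorem lintegral_average_marginal (Ψ : (Kf × F) ≃L[ℝ] E) {σ : F → E} (hσm : Measurable σ)
    (hσ : ∀ b, (Ψ.symm (σ b)).2 = b) {O : Set E} (hO : MeasurableSet O) {Φ : E → E} (hΦm : Measurable Φ)
    (hinj : InjOn Φ O) {Φ' : E → E →L[ℝ] E} (hΦ' : ∀ y ∈ O, HasFDerivWithinAt Φ (Φ' y) O y)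
    (G : E → ℝ≥0∞) {Gt : E → ℝ≥0∞} (hGtm : Measurable Gt)
    (hGt : ∀ y, Gt y = O.indicator (fun y => ENNReal.ofReal |(Φ' y).det| * G (Φ y)) y)
    {Q : E → F} (hQ : Measurable Q) (hlin : ∀ y ∈ O, Q (Φ y) = (Ψ.symm y).2)
    {φ : F → ℝ≥0∞} (hφ : Measurable φ) :
    ∃ c : ℝ≥0∞, c ≠ 0 ∧ c ≠ ∞ ∧
      c * ∫⁻ y, φ (Q y) ∂((μE.restrict (Φ '' O)).withDensity G) =
        ∫⁻ b, φ b * ∫⁻ x, Gt (σ b + Ψ (x, 0)) ∂μK ∂μF := by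
  obtain ⟨c, hc0, hc1, h⟩ := lintegral_average_linearizedChart μE μK μF Ψ hσm hσ hO hΦm hinj hΦ' G hGtm hGt hQ
    hlin (g := fun q : F × E => φ q.1) (hφ.comp measurable_fst)
  refine ⟨c, hc0, hc1, ?_⟩
  rw [h]
  refine lintegral_congr fun b => ?_
  have hm : Measurable fun x : Kf => Gt (σ b + Ψ (x, 0)) :=
    hGtm.comp (measurable_const.add (Ψ.continuous.measurable.comp (measurable_id.prodMk measurable_const)))
  rw [← lintegral_const_mul _ hm]

end Summit.QuantumFields.BalabanUV.T4Continuum.ShellMeasureLinearizedDisintegration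

end
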